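import Summits.BirchSwinnertonDyer.BirchSwinnertonDyer.Theorems.SignedLowerHalvesSmallImageLowerHalfBothSignsRttD2SeqJ3HControlLocal
import Summits.BirchSwinnertonDyer.BirchSwinnertonDyer.Theorems.SignedLowerHalvesSmallImageLowerHalfBothSignsRttD2SeqJ3RTorsion
import Summits.BirchSwinnertonDyer.BirchSwinnertonDyer.Theorems.SignedLowerHalvesSmallImageLowerHalfBothSignsRttD2SeqJ3Good
import Literature.NumberTheory.EllipticCurves.TwoVariableControlLocalKernelProofs
import Literature.NumberTheory.EllipticCurves.SelmerCorankProofs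
import Literature.NumberTheory.EllipticCurves.SelmerProofs
import Literature.NumberTheory.EllipticCurves.H1CorestrictionIndexTwo
import Literature.NumberTheory.GaloisRepresentations.RestrictedRamification
import Literature.NumberTheory.GaloisRepresentations.DecompositionGroupOfCompletion
import Literature.NumberTheory.GaloisRepresentations.IntegralGaloisActionProofs
import HarnessLib

/-!
# Route `SignedLowerHalves`, crux L `SmallImageLowerHalfBothSigns` (stmt-BirchSwinnertonDyer-23599), line `rtt_w3` v16–v20 — E2, row J3 residual
# (`hsolL`), brick H5b: ★★★ THE LAYER ORTHOGONALITY `horth` OF H7a FROM `hq` — a character `q` of `E^ε_{sat,v}` killing `loc_v(Sel^{ε,S₀}_𝒪(K_∞, M))`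
# kills the class of every admissible global torsion-level class `c ∈ H¹(U_m, M[p^m])` whose layer localisation is good

WIDTH seat `bsd-line-slh-p3-w3` g24 under LEAD `cruxlead-stmt-BirchSwinnertonDyer-23599` g12 (cell `bsd-ssimc`); helper `--supports stmt-BirchSwinnertonDyer-23599`.
THEOREMS ONLY (no definition, no named fact, no instance, no `sorry`). HONEST FRAMING: this is the CONTROL step of Kobayashi's Thm. 7.3 i) in the line's currency:
`res_{m→∞}(loc_{v,m} c_K) ∈ E^ε_{sat,v}` forces `res_{m→N} c_K ∈ Sel^{ε,S₀}_𝒪(K_N, M)` for ONE deeper layer `N` (H5a: monotone layer conditions + exhaustion; here: the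
unramified conditions prime by prime, the one orbit of `Γ_{K_v}` on `Γ_K ⧸ U_m` at the non-split `v`, and "a local coboundary is the restriction of a global one"), whence
`q(ι_∞ θ^* c) = q(loc_v s) = 0` for `s = res_{N→∞} c_N ∈ Sel_∞`. With H7a (`exists_mem_strictLevel_locPairNK_eq_of_orth`, p800127) this gives `hsolL` (brick H7b, next file).
Hypotheses: `v` the ONLY place above `p` (`hpv`), `p ∈ v` (`hvp`), `v` non-split in `K_∞` (`hv`), open stabilisers (`hstabK`, `hstab`). Nothing about any curve; E2, crux L,
crux M, BSD remain OPEN and are proved for NO curve.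

* §1 generic: `conjH1_mem_unramifiedKer_of_forall_primesAbove_resOfLe_eq_zero` (prime-form ⟹ σ-form of the unramified condition, ANY action),
  `exists_resGalOfEmb_mul_eq_of_isNonsplitIn` (one orbit), `locH1Layer_comp_conjH1`, `resOfLe_comp_resH1Hom_resGalSubgroupOfEmb` / `resOfLe_comp_locH1Layer_layer`
  (naturality of `loc_{v,n}`; the generic form keeps the kernel from unfolding the layer subgroups),
  ★ `mem_localKummerTransportSat_of_locH1Layer_mem` (`loc_{v,n} c ∈ E^ε_{sat}(K_n·K_v) ⇒ c` satisfies the GLOBAL saturated condition at `v`),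
  `resOfLe_torsToH1_mem_unramifiedOutside` (admissible torsion-level classes restrict into `unramifiedOutside`);
* §2 ★★★ `horth_of_hq` — the hypothesis `horth` of p800127 VERBATIM, from `hq : ∀ s ∈ Sel_∞, q (locSat s) = 0`.
References: [Kobayashi2003] Def. 1.1, Thm. 7.3 i); [SerreGaloisCohomology1997] I §2.2 Prop. 8, I §5.1, II §1.1; [GreenbergVatsal2000] §2 pp. 16–17; [NeukirchANT1999] I §9 (9.1),
II §9 (9.6); [Rubin2000] §1.7, §4.2.
-/

set_option autoImplicit false
set_option linter.dupNamespace false -- D-0017: single-problem summit, the namespace repeats the problem name by design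
noncomputable section

open scoped Classical Pointwise
open NumberField IsDedekindDomain Field CategoryTheory Function

namespace Summit.BirchSwinnertonDyer.BirchSwinnertonDyer.Theorems.SmallImageRttD2Seq

open Literature.NumberTheory.EllipticCurves Literature.NumberTheory.EllipticCurves.Kobayashi2003
  Literature.NumberTheory.EllipticCurves.GreenbergVatsal2000 Literature.NumberTheory.EllipticCurves.GreenbergSelmer
  Literature.NumberTheory.GaloisRepresentations
  Summit.BirchSwinnertonDyer.BirchSwinnertonDyer.Theorems.SmallImageCharSignedSelmer

/-! ## §1. Generic lemmas -/

section Unramified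

variable {K : Type} [Field K] [NumberField K]
  {M : Type} [AddCommGroup M] [DistribMulAction (absoluteGaloisGroup K) M] [TopologicalSpace M] [DiscreteTopology M]

/-- **prime-form ⟹ σ-form for the unramified condition, ANY action.** If `c ∈ H¹(H, M)` (`H ⊴ Γ_K`) dies on `H ⊓ I_𝔓` for EVERY prime `𝔓` of `ℤ̄_K` above `w`,
then every conjugate `conj_σ c` lies in `unramifiedKer H M w` (dies on `H ⊓ I_w` for the chosen prime `𝔓₀` above `w`): on cocycles, `x ↦ σ • z(σ⁻¹xσ)` with
`σ⁻¹xσ ∈ H ⊓ I_{σ⁻¹𝔓₀}`, where `z = ∂a`, is `∂(σ • a)`. [cite: GreenbergVatsal2000, §2 p. 17] [cite: NeukirchANT1999, Ch. I §9 (9.1), Ch. II §9 (9.6)] -/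
theorem conjH1_mem_unramifiedKer_of_forall_primesAbove_resOfLe_eq_zero (H : Subgroup (absoluteGaloisGroup K)) [H.Normal]
    {w : HeightOneSpectrum (𝓞 K)} {c : subgroupH1 H M}
    (h : ∀ 𝔓 ∈ w.primesAbove, resOfLe M (inf_le_left : H ⊓ 𝔓.inertia (absoluteGaloisGroup K) ≤ H) c = 0) (σ : absoluteGaloisGroup K) :
    conjH1 H M σ c ∈ unramifiedKer H M w := by
  obtain ⟨z, rfl⟩ := oneCocycleClass_surjective _ c
  rw [mem_unramifiedKer_iff_resOfLe_eq_zero, CocycleCriteria.conjH1_oneCocycleClass_mem_ker_resOfLe_iff]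
  -- the chosen prime `𝔓₀` over `w` (inertia `inertia w`) and its translate `σ⁻¹ • 𝔓₀`
  have hI₀ : GreenbergSelmer.inertia w = (adicCompletionPrime K w).inertia (absoluteGaloisGroup K) :=
    (inertia_adicCompletionPrime_eq_map_absInertia K w).symm
  have h𝔓 : σ⁻¹ • adicCompletionPrime K w ∈ w.primesAbove := smul_mem_primesAbove (adicCompletionPrime_mem_primesAbove K w) σ⁻¹
  have hz := h _ h𝔓
  rw [CocycleCriteria.resOfLe_oneCocycleClass_eq_zero_iff] at hz
  obtain ⟨a, ha⟩ := hz
  refine ⟨σ • a, fun x ↦ ?_⟩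
  obtain ⟨hxH, hxI⟩ := Subgroup.mem_inf.mp x.2
  have hxI' : (x : absoluteGaloisGroup K) ∈ (adicCompletionPrime K w).inertia (absoluteGaloisGroup K) := by
    rw [← hI₀]; exact hxI
  -- `σ⁻¹ x σ ∈ H ⊓ I_{σ⁻¹ 𝔓₀}`
  have hyI : σ⁻¹ * (x : absoluteGaloisGroup K) * σ ∈ (σ⁻¹ • adicCompletionPrime K w).inertia (absoluteGaloisGroup K) := by
    have h' := conj_mem_inertia_smul hxI' σ⁻¹
    rwa [inv_inv] at h'
  have hyH : σ⁻¹ * (x : absoluteGaloisGroup K) * σ ∈ H := by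
    have h' := ‹H.Normal›.conj_mem _ hxH σ⁻¹
    rwa [inv_inv] at h'
  have hconj : subgroupConj H σ (Subgroup.inclusion (inf_le_left : H ⊓ GreenbergSelmer.inertia w ≤ H) x) =
      Subgroup.inclusion (inf_le_left : H ⊓ (σ⁻¹ • adicCompletionPrime K w).inertia (absoluteGaloisGroup K) ≤ H)
        ⟨σ⁻¹ * (x : absoluteGaloisGroup K) * σ, Subgroup.mem_inf.mpr ⟨hyH, hyI⟩⟩ :=
    Subtype.ext (by rw [subgroupConj_apply_coe]; rfl)
  rw [hconj, ha]
  change σ • ((σ⁻¹ * (x : absoluteGaloisGroup K) * σ) • a - a) = (x : absoluteGaloisGroup K) • (σ • a) - σ • a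
  rw [smul_sub, smul_smul, ← mul_assoc, ← mul_assoc, mul_inv_cancel, one_mul, mul_smul]

end Unramified

section Layer

variable {K : Type} [Field K] [NumberField K] {p : ℕ} [Fact p.Prime] (κ : ZpExtension K p) (v : HeightOneSpectrum (𝓞 K))
  (M : Type) [AddCommGroup M] [TopologicalSpace M] [DiscreteTopology M] [DistribMulAction (absoluteGaloisGroup K) M]
  (R : Type*) [Ring R] [Module R M]

/-- **One orbit at a non-split place**: if `κ ∘ res_v` is onto `κ(Γ_K)` (`AcSigned.IsNonsplitIn κ v`), every `g ∈ Γ_K` is `res_v(τ) · u` with `τ ∈ Γ_{K_v}` and `u ∈ U_n`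
(every layer `n`; indeed `u ∈ Gal(K̄/K_∞)`). [cite: NeukirchSchmidtWingberg2008, I §5 (1.5.7)] -/
theorem exists_resGalOfEmb_mul_eq_of_isNonsplitIn (hv : AcSigned.IsNonsplitIn κ v) (n : ℕ) (g : absoluteGaloisGroup K) :
    ∃ (τ : absoluteGaloisGroup (v.adicCompletion K)) (u : absoluteGaloisGroup K), u ∈ κ.layerSubgroup n ∧
      g = resGalOfEmb (closureEmb (K := K) (v.adicCompletion K)) τ * u := by
  obtain ⟨τ, hτ⟩ := hv (κ g)
  have hτ' : κ (resGalOfEmb (closureEmb (K := K) (v.adicCompletion K)) τ) = κ g := hτ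
  refine ⟨τ, (resGalOfEmb (closureEmb (K := K) (v.adicCompletion K)) τ)⁻¹ * g, κ.kerSubgroup_le_layerSubgroup n ?_, by group⟩
  rw [ZpExtension.mem_kerSubgroup, map_mul, map_inv, hτ', inv_mul_cancel]

variable [DistribMulAction (absoluteGaloisGroup (v.adicCompletion K)) M]
  (hres : ∀ (σ : absoluteGaloisGroup (v.adicCompletion K)) (m : M), σ • m = resGalOfEmb (closureEmb (K := K) (v.adicCompletion K)) σ • m)

/-- **`loc_{v,n}` intertwines the conjugation actions** (layer version of `locH1_comp_conjH1`): `loc_{v,n} ∘ conj_{res_v σ} = conj_σ ∘ loc_{v,n}` on `H¹(U_n, M)`, for `σ ∈ Γ_{K_v}`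
(both composites are the map of the pair `(τ ↦ res(σ)⁻¹ res(τ) res(σ), m ↦ res(σ) • m)`). [cite: NeukirchSchmidtWingberg2008, I §5] -/
theorem locH1Layer_comp_conjH1 (n : ℕ) (σ : absoluteGaloisGroup (v.adicCompletion K)) :
    haveI := normal_localSubgroupOfEmb_layerSubgroup κ v n
    (locH1Layer κ M v hres n).comp (conjH1 (κ.layerSubgroup n) M (resGalOfEmb (closureEmb (K := K) (v.adicCompletion K)) σ)) =
      (conjH1 (localSubgroupOfEmb (κ.layerSubgroup n) (closureEmb (K := K) (v.adicCompletion K))) M σ).comp (locH1Layer κ M v hres n) := by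
  haveI := normal_localSubgroupOfEmb_layerSubgroup κ v n
  rw [locH1Layer, conjH1, conjH1, resH1Hom_comp, resH1Hom_comp]
  refine resH1Hom_congr ?_ ?_ _ _
  · refine ContinuousMonoidHom.ext fun τ ↦ Subtype.ext ?_
    change (resGalOfEmb _ σ)⁻¹ * resGalOfEmb _ (τ : absoluteGaloisGroup (v.adicCompletion K)) * resGalOfEmb _ σ =
      resGalOfEmb _ (σ⁻¹ * (τ : absoluteGaloisGroup (v.adicCompletion K)) * σ)
    rw [map_mul, map_mul, map_inv]
  · ext m
    change resGalOfEmb (closureEmb (K := K) (v.adicCompletion K)) σ • m = σ • m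
    rw [hres]

/-- Restriction along nested subgroups `H′ ≤ H ≤ Γ_K` commutes with the localisation maps `H¹(H, M) → H¹(H_v, M)` (`H_v = res_v⁻¹ H`): both composites are the map of the
pair `(H′_v → H, id_M)`. Generic in `H′ ≤ H` (so that the kernel only instantiates). [cite: SerreGaloisCohomology1997, I §2.5] -/
theorem resOfLe_comp_resH1Hom_resGalSubgroupOfEmb {H H' : Subgroup (absoluteGaloisGroup K)} (hH : H' ≤ H)
    (h₁ : ∀ (x : localSubgroupOfEmb H (closureEmb (K := K) (v.adicCompletion K))) (m : M),
      AddMonoidHom.id M ((resGalSubgroupOfEmb H (closureEmb (K := K) (v.adicCompletion K)) x) • m) = x • AddMonoidHom.id M m)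
    (h₂ : ∀ (x : localSubgroupOfEmb H' (closureEmb (K := K) (v.adicCompletion K))) (m : M),
      AddMonoidHom.id M ((resGalSubgroupOfEmb H' (closureEmb (K := K) (v.adicCompletion K)) x) • m) = x • AddMonoidHom.id M m) :
    (resOfLe M (Subgroup.comap_mono hH : localSubgroupOfEmb H' (closureEmb (K := K) (v.adicCompletion K)) ≤
        localSubgroupOfEmb H (closureEmb (K := K) (v.adicCompletion K)))).comp
        (resH1Hom (resGalSubgroupOfEmb H (closureEmb (K := K) (v.adicCompletion K))) (AddMonoidHom.id M) h₁) =
      (resH1Hom (resGalSubgroupOfEmb H' (closureEmb (K := K) (v.adicCompletion K))) (AddMonoidHom.id M) h₂).comp (resOfLe M hH) := by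
  rw [resOfLe, resOfLe, resH1Hom_comp, resH1Hom_comp]
  exact resH1Hom_congr (by ext; rfl) (by ext; rfl) _ _

/-- **`loc_{v,·}` is compatible with the layer restrictions**: `res^{loc}_{n→n′} ∘ loc_{v,n} = loc_{v,n′} ∘ res_{n→n′}` (both are restriction along `U_{n′,v} → U_n`).
[cite: SerreGaloisCohomology1997, I §2.5] -/
theorem resOfLe_comp_locH1Layer_layer {n n' : ℕ} (hn : n ≤ n') :
    (resOfLe M (localSubgroupOfEmb_layerSubgroup_antitone κ v hn)).comp (locH1Layer κ M v hres n) =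
      (locH1Layer κ M v hres n').comp (resOfLe M (κ.layerSubgroup_antitone hn)) := by
  rw [locH1Layer, locH1Layer]
  exact resOfLe_comp_resH1Hom_resGalSubgroupOfEmb v M (κ.layerSubgroup_antitone hn) _ _

/-- ★ **A local coboundary is the restriction of a global one**: if `loc_{v,n} c ∈ E^ε_{sat}(K_n·K_v)` for a GLOBAL class `c ∈ H¹(U_n, M)` (`M` with open stabilisers in
`Γ_K`), then `c` satisfies the global saturated transported condition at `v` (`localKummerTransportSat`): a representative `φ₀` of `c` restricts to `φ′ − ∂m` with `φ′` in the
span of the generators, and `φ₀ + ∂m` is a representative of `c` restricting to `φ′`. [cite: Kobayashi2003, Def. 1.1] [cite: SerreGaloisCohomology1997, I §5.1] -/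
theorem mem_localKummerTransportSat_of_locH1Layer_mem (V : WeierstrassCurve K) (j : V.geomPrimaryTorsion p →+ M) (ε : ℤˣ)
    (hstabK : ∀ m : M, IsOpen (MulAction.stabilizer (absoluteGaloisGroup K) m : Set (absoluteGaloisGroup K))) (n : ℕ)
    {c : subgroupH1 (κ.layerSubgroup n) M} (hc : locH1Layer κ M v hres n c ∈ localCondLayerSat κ M R V j ε v n) :
    c ∈ localKummerTransportSat V p (κ.layerSubgroup n) (closureEmb (K := K) (v.adicCompletion K)) M R j
      (signedLocalPoints κ (v.adicCompletion K) V ε n) := by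
  obtain ⟨φ₀, rfl⟩ := oneCocycleClass_surjective (discreteTopRep (κ.layerSubgroup n) M) c
  obtain ⟨φ₁, hφ₁, hfun₁⟩ := locH1Layer_oneCocycleClass κ M v hres n φ₀
  obtain ⟨φ', hφ', hmem⟩ := hc
  -- `φ' − φ₁` is a local coboundary `∂m`
  have h0 : oneCocycleClass _ (φ' - φ₁) = 0 := by rw [oneCocycleClass_sub, hφ', hφ₁, sub_self]
  rw [oneCocycleClass_eq_zero_iff] at h0
  obtain ⟨m, hm⟩ := h0
  have hcont : Continuous fun x : κ.layerSubgroup n ↦ x • m :=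
    (continuous_smul_of_isOpen_stabilizer m (hstabK m)).comp continuous_subtype_val
  refine ⟨φ₀ + cobCocycle m hcont, by rw [oneCocycleClass_add, oneCocycleClass_cobCocycle, add_zero], ?_⟩
  have hfun : (fun τ : localSubgroupOfEmb (κ.layerSubgroup n) (closureEmb (K := K) (v.adicCompletion K)) ↦
      (φ₀ + cobCocycle m hcont).1 (resGalSubgroupOfEmb (κ.layerSubgroup n) (closureEmb (K := K) (v.adicCompletion K)) τ)) =
      (⇑φ'.1 : localSubgroupOfEmb (κ.layerSubgroup n) (closureEmb (K := K) (v.adicCompletion K)) → M) := by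
    funext τ
    have h1 : φ'.1 τ = φ₁.1 τ + ((τ : absoluteGaloisGroup (v.adicCompletion K)) • m - m) := by
      have h := hm τ
      rw [sub_apply_val, sub_eq_iff_eq_add'] at h
      exact h
    have h2 : φ₁.1 τ = φ₀.1 (resGalSubgroupOfEmb (κ.layerSubgroup n) (closureEmb (K := K) (v.adicCompletion K)) τ) := congrFun hfun₁ τ
    rw [add_apply_val, cobCocycle_apply, h1, h2, Subgroup.smul_def, resGalSubgroupOfEmb_apply_coe, hres]
  rw [hfun]
  exact hmem

omit [DistribMulAction (absoluteGaloisGroup (v.adicCompletion K)) M] in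
/-- **Admissible torsion-level classes restrict into `unramifiedOutside`.** If `c ∈ H¹(U_m, M[p^k])` dies on `U_m ⊓ I_𝔓` for every prime `𝔓` over every place `w ≠ v`, `w ∉ S₀`,
and `p ∈ v`, then for `m ≤ n` the class `res_{m→n}(torsToH1 c) ∈ H¹(U_n, M)` lies in Greenberg–Vatsal's `unramifiedOutside U_n M p S₀` (all conjugates, all `w ∉ S₀` with `p ∉ w`).
[cite: GreenbergVatsal2000, §2 pp. 16–17] [cite: SerreGaloisCohomology1997, I §5.1] -/
theorem resOfLe_torsToH1_mem_unramifiedOutside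
    (hstabK : ∀ m : M, IsOpen (MulAction.stabilizer (absoluteGaloisGroup K) m : Set (absoluteGaloisGroup K)))
    (S₀ : Set (HeightOneSpectrum (𝓞 K))) (hvp : ((p : ℕ) : 𝓞 K) ∈ v.asIdeal) {m n : ℕ} (hmn : m ≤ n) (k : ℕ)
    (c : subgroupH1 (κ.layerSubgroup m) ↥(torsionPow M p k))
    (hcur : ∀ w : HeightOneSpectrum (𝓞 K), w ≠ v → w ∉ S₀ → ∀ 𝔓 ∈ w.primesAbove,
      resLe (torsRep M hstabK p k).toTopRep (inf_le_left : κ.layerSubgroup m ⊓ 𝔓.inertia (absoluteGaloisGroup K) ≤ κ.layerSubgroup m) 1 c = 0) :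
    resOfLe M (κ.layerSubgroup_antitone hmn) (torsToH1 M p (κ.layerSubgroup m) k c) ∈ unramifiedOutside (κ.layerSubgroup n) M p S₀ := by
  rw [mem_unramifiedOutside_iff]
  intro w hwS hwp σ
  have hwv : w ≠ v := fun h ↦ hwp (h ▸ hvp)
  refine conjH1_mem_unramifiedKer_of_forall_primesAbove_resOfLe_eq_zero (κ.layerSubgroup n) (fun 𝔓 h𝔓 ↦ ?_) σ
  -- the hypothesis in the `resOfLe` dialect (definitionally the `resLe` one, `resLe_torsRep_eq_resOfLe`)
  have h1 : resOfLe ↥(torsionPow M p k) (inf_le_left : κ.layerSubgroup m ⊓ 𝔓.inertia (absoluteGaloisGroup K) ≤ κ.layerSubgroup m) c =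
      (0 : subgroupH1 (κ.layerSubgroup m ⊓ 𝔓.inertia (absoluteGaloisGroup K)) ↥(torsionPow M p k)) := hcur w hwv hwS 𝔓 h𝔓
  have h2 : resOfLe M (inf_le_left : κ.layerSubgroup m ⊓ 𝔓.inertia (absoluteGaloisGroup K) ≤ κ.layerSubgroup m) (torsToH1 M p (κ.layerSubgroup m) k c) = 0 := by
    rw [← torsToH1_resOfLe, h1, map_zero]
  have hle : κ.layerSubgroup n ⊓ 𝔓.inertia (absoluteGaloisGroup K) ≤ κ.layerSubgroup m ⊓ 𝔓.inertia (absoluteGaloisGroup K) :=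
    inf_le_inf_right _ (κ.layerSubgroup_antitone hmn)
  rw [← AddMonoidHom.comp_apply, resOfLe_comp_holds,
    ← resOfLe_comp_holds (M := M) hle (inf_le_left : κ.layerSubgroup m ⊓ 𝔓.inertia (absoluteGaloisGroup K) ≤ κ.layerSubgroup m),
    AddMonoidHom.comp_apply, h2, map_zero]

end Layer

/-! ## §2. The layer orthogonality `horth` from `hq` -/

section Orth

variable {K : Type} [Field K] [NumberField K] {p : ℕ} [Fact p.Prime] (S : Set (PadicAlgCl p)) (κ : ZpExtension K p) (v : HeightOneSpectrum (𝓞 K))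
  (M : Type) [AddCommGroup M] [TopologicalSpace M] [DiscreteTopology M] [DistribMulAction (absoluteGaloisGroup K) M]
  [Module (padicCoeffIntegers S) M]
  (hstabK : ∀ m : M, IsOpen (MulAction.stabilizer (absoluteGaloisGroup K) m : Set (absoluteGaloisGroup K)))

/-- ★★★ **The layer orthogonality `horth` of H7a from `hq`.** Let `v` be the only place of `K` above `p`, non-split in `K_∞/K`, `M` a discrete `Γ_K`-module with open
stabilisers carrying the `Γ_{K_v}`-action `localAction`, and `q : E^ε_{sat,v} → ℚ/ℤ` a character killing `loc_v(Sel^{ε,S₀}_𝒪(K_∞, M))`. Then for every level `m` and every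
global `c ∈ H¹(U_m, M[p^m])` dying on `U_m ⊓ I_𝔓` for all primes `𝔓` over the places `w ∉ S₀ ∪ {v}` whose layer localisation `θ^* c` is GOOD, `q(ι_∞ θ^* c) = 0`.
PROOF: `ι_∞ θ^* c = res_{m→∞} loc_{v,m} c_K` (`c_K = torsToH1 c`, R5); H5a gives ONE layer `N ≥ m` with `res_{m→N}(conj_τ loc_{v,m} c_K) ∈ E^ε_{sat}(K_N·K_v)` for all
`τ ∈ Γ_{K_v}`; then `c_N := res_{m→N} c_K ∈ Sel^{ε,S₀}_𝒪(K_N, M)` (unramified conditions from admissibility; Kummer conditions at `v` for ALL `Γ_K`-conjugates since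
`Γ_K = res_v(Γ_{K_v}) · U_m` and a local coboundary is the restriction of a global one), so `s := res_{N→∞} c_N ∈ Sel_∞` has `loc_v s = ι_∞ θ^* c` and `q` kills it.
[cite: Kobayashi2003, Thm. 7.3 i), Def. 1.1] [cite: SerreGaloisCohomology1997, I §2.2 Prop. 8] [cite: GreenbergVatsal2000, §2 pp. 16–17] [cite: Rubin2000, §1.7, §4.2] -/
theorem horth_of_hq (V : WeierstrassCurve K) (j : V.geomPrimaryTorsion p →+ M) (S₀ : Set (HeightOneSpectrum (𝓞 K))) (ε : ℤˣ)
    (hvp : ((p : ℕ) : 𝓞 K) ∈ v.asIdeal) (hpv : ∀ w : HeightOneSpectrum (𝓞 K), ((p : ℕ) : 𝓞 K) ∈ w.asIdeal → w = v) (hv : AcSigned.IsNonsplitIn κ v)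
    (hstab : letI := localAction (closureEmb (K := K) (v.adicCompletion K)) M
      ∀ m : M, IsOpen (MulAction.stabilizer (absoluteGaloisGroup (v.adicCompletion K)) m : Set (absoluteGaloisGroup (v.adicCompletion K))))
    (q : letI := localAction (closureEmb (K := K) (v.adicCompletion K)) M
      localCondInftySat κ M (padicCoeffIntegers S) V j ε v →+ AddCircle (1 : ℚ))
    (hq : letI := localAction (closureEmb (K := K) (v.adicCompletion K)) M
      ∀ s : signedTransportSelmerInftySat κ M (padicCoeffIntegers S) V j S₀ ε,
        q (locSat κ M (padicCoeffIntegers S) V j S₀ ε v (fun _ _ ↦ rfl) hvp s) = 0)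
    (m : ℕ) (c : subgroupH1 (κ.layerSubgroup m) ↥(torsionPow M p m))
    (hcur : ∀ w : HeightOneSpectrum (𝓞 K), w ≠ v → w ∉ S₀ → ∀ 𝔓 ∈ w.primesAbove,
      resLe (torsRep M hstabK p m).toTopRep (inf_le_left : κ.layerSubgroup m ⊓ 𝔓.inertia (absoluteGaloisGroup K) ≤ κ.layerSubgroup m) 1 c = 0)
    (hc : letI := localAction (closureEmb (K := K) (v.adicCompletion K)) M
      ContinuousCohomology.map (comapSubtypeHom (κ.layerSubgroup m) (resGalOfEmb (closureEmb (K := K) (v.adicCompletion K))))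
        (comapCoeffHom (torsRep M hstabK p m).toTopRep (κ.layerSubgroup m) (resGalOfEmb (closureEmb (K := K) (v.adicCompletion K)))) 1 c ∈
        goodLevel S κ v M V j ε m m) :
    letI := localAction (closureEmb (K := K) (v.adicCompletion K)) M
    q ⟨_, hc⟩ = 0 := by
  letI := localAction (closureEmb (K := K) (v.adicCompletion K)) M
  haveI := normal_localSubgroupOfEmb_layerSubgroup κ v m
  -- the `M`-valued class `c_K` and its layer localisation `ℓt = loc_{v,m} c_K = torsToH1 (θ^* c)`
  obtain ⟨cK, hcK⟩ : ∃ cK : subgroupH1 (κ.layerSubgroup m) M, cK = torsToH1 M p (κ.layerSubgroup m) m c := ⟨_, rfl⟩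
  obtain ⟨ℓt, hℓt⟩ : ∃ ℓt : subgroupH1 (localSubgroupOfEmb (κ.layerSubgroup m) (closureEmb (K := K) (v.adicCompletion K))) M,
      ℓt = locH1Layer κ M v (fun _ _ ↦ rfl) m cK := ⟨_, rfl⟩
  have hℓt' : torsToH1 M p (localSubgroupOfEmb (κ.layerSubgroup m) (closureEmb (K := K) (v.adicCompletion K))) m
      (ContinuousCohomology.map (comapSubtypeHom (κ.layerSubgroup m) (resGalOfEmb (closureEmb (K := K) (v.adicCompletion K))))
        (comapCoeffHom (torsRep M hstabK p m).toTopRep (κ.layerSubgroup m) (resGalOfEmb (closureEmb (K := K) (v.adicCompletion K)))) 1 c) = ℓt := by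
    rw [hℓt, hcK]; exact torsToH1_map_comapSubtypeHom κ v M hstabK m m c
  have hgood : resOfLe M (localSubgroupOfEmb_kerSubgroup_le κ v m) ℓt ∈ localCondInftySat κ M (padicCoeffIntegers S) V j ε v := by
    rw [← hℓt']; exact (mem_goodLevel_iff S κ v M V j ε m m _).mp hc
  -- H5a: ONE layer `N ≥ m` for all conjugates
  obtain ⟨N, hmN, hN⟩ := exists_forall_resOfLe_conjH1_mem_localCondLayerSat hstab ℓt hgood
  -- the global class at layer `N` lies in the layer Selmer group
  have hSel : resOfLe M (κ.layerSubgroup_antitone hmN) cK ∈ signedTransportSelmerLayerSat κ M (padicCoeffIntegers S) V j S₀ ε N := by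
    rw [mem_signedTransportSelmerLayerSat_iff]
    refine ⟨?_, fun w hw σ ↦ ?_⟩
    · rw [hcK]; exact resOfLe_torsToH1_mem_unramifiedOutside κ v M hstabK S₀ hvp hmN m c hcur
    obtain rfl : w = v := hpv w hw
    obtain ⟨τ, u, hu, rfl⟩ := exists_resGalOfEmb_mul_eq_of_isNonsplitIn κ w hv m σ
    refine mem_localKummerTransportSat_of_locH1Layer_mem κ w M (padicCoeffIntegers S) (fun _ _ ↦ rfl) V j ε hstabK N ?_
    have e1 : conjH1 (κ.layerSubgroup N) M (resGalOfEmb (closureEmb (K := K) (w.adicCompletion K)) τ * u) (resOfLe M (κ.layerSubgroup_antitone hmN) cK) =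
        resOfLe M (κ.layerSubgroup_antitone hmN) (conjH1 (κ.layerSubgroup m) M (resGalOfEmb (closureEmb (K := K) (w.adicCompletion K)) τ) cK) := by
      rw [← AddMonoidHom.comp_apply, ← resOfLe_comp_conjH1_holds, AddMonoidHom.comp_apply, conjH1_mul_holds, AddMonoidHom.comp_apply,
        conjH1_of_mem_holds _ M hu, AddMonoidHom.id_apply]
    have e2 : locH1Layer κ M w (fun _ _ ↦ rfl) N (resOfLe M (κ.layerSubgroup_antitone hmN)
        (conjH1 (κ.layerSubgroup m) M (resGalOfEmb (closureEmb (K := K) (w.adicCompletion K)) τ) cK)) =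
        resOfLe M (localSubgroupOfEmb_layerSubgroup_antitone κ w hmN)
          (conjH1 (localSubgroupOfEmb (κ.layerSubgroup m) (closureEmb (K := K) (w.adicCompletion K))) M τ ℓt) := by
      rw [← AddMonoidHom.comp_apply, ← resOfLe_comp_locH1Layer_layer κ w M (fun _ _ ↦ rfl) hmN, AddMonoidHom.comp_apply,
        ← AddMonoidHom.comp_apply (locH1Layer κ M w _ m),
        locH1Layer_comp_conjH1, AddMonoidHom.comp_apply, hℓt]
    rw [e1, e2]
    exact hN τ
  -- the class at the top of the tower lies in `Sel_∞`, and its localisation is the element of `hc`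
  have hs : resOfLe M (κ.kerSubgroup_le_layerSubgroup N) (resOfLe M (κ.layerSubgroup_antitone hmN) cK) ∈
      signedTransportSelmerInftySat κ M (padicCoeffIntegers S) V j S₀ ε :=
    map_resOfLe_signedTransportSelmerLayerSat_le κ M (padicCoeffIntegers S) V j S₀ ε N ⟨_, hSel, rfl⟩
  have hval : (⟨_, hc⟩ : ↥(localCondInftySat κ M (padicCoeffIntegers S) V j ε v)) =
      locSat κ M (padicCoeffIntegers S) V j S₀ ε v (fun _ _ ↦ rfl) hvp ⟨_, hs⟩ := by
    apply Subtype.ext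
    rw [coe_locSat_apply]
    change resOfLe M (localSubgroupOfEmb_kerSubgroup_le κ v m) (torsToH1 M p _ m _) =
      locH1 κ M v _ (resOfLe M (κ.kerSubgroup_le_layerSubgroup N) (resOfLe M (κ.layerSubgroup_antitone hmN) cK))
    rw [hℓt', hℓt, ← AddMonoidHom.comp_apply, resOfLe_comp_locH1Layer, AddMonoidHom.comp_apply, ← AddMonoidHom.comp_apply (resOfLe M _) (resOfLe M _),
      resOfLe_comp_holds]
  rw [hval]
  exact hq _

end Orth

end Summit.BirchSwinnertonDyer.BirchSwinnertonDyer.Theorems.SmallImageRttD2Seq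

end
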